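import Summits.HodgeConjecture.CorCM.Census.CyclicCharacterEvenCertificate

/-!
# Cyclic characters, XXIX: THE EVEN CYCLIC-SYLOW LAW — `μ(G, c) = φ₂(G, c) = β(G, c) − 1` for `w ↠ ℤ/2ᵏ` (`k ≥ 2`), EVEN kernel, `d = 1`

COR-CM (cell `pub-hodgecm2`), count-neutral kernel combinatorics by the binder seat b09 (gen 43; lane CYCLIC-CHARACTER FIBRE LAW, part XXIX), on part XXVIII
(`exists_evenCert_generate`), gen 41ʼs fibre laws (`fibreTwo_add_one/two_eq_card_block`), the floor `Coinvariant.fibreTwo_le_card_of_faces` and gen 42ʼs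
odd-kernel law (part XXIII `isLeast_card_gfaces_generate_of_cyclic`) BY NAME.  Theorems only (no definition, no `decide`, no certificate, no named fact, no `sorry`).
HONEST FRAMING: `HC_CM` is NOT proved, here or anywhere in the tree; nothing here is a period or a headline.

* **THE EVEN CYCLIC-SYLOW LAW** (`isLeast_card_gfaces_generate_of_even`, `…_card_block`): `G` finite, `c` a central involution, `w : G ↠ ℤ/2ᵏ` additive
  (`k ≥ 2`) with `w c ≠ 0`, kernel of EVEN size `2m ≥ 4` (any structure), `d = 1` (every `g` with `w g` odd has `c ∈ ⟨g⟩`) ⟹ **`μ(G, c) = φ₂(G, c) = β(G, c) − 1`**.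
* **`d = 0`** (`exists_gfaces_generate_of_even_nonroot`): `φ₂ + 2 = β` and **`φ₂ ≤ μ ≤ φ₂ + 1`** — tightness is OPEN (numerics and the localized mechanism:
  `HOME/pub-hodgecm2-b09/lean-g43/EVEN-KERNEL-ROADMAP.md`).
* **ONE STATEMENT FOR EVERY KERNEL OF SIZE `≥ 3`** (`isLeast_card_gfaces_generate_of_roots`, `…_card_block`): with gen 42ʼs odd-kernel law, `|ker w| ≥ 3` and
  `d = 1` ⟹ `μ = φ₂ = β − 1`.  Hence `μ = φ₂` for every `(G, c)` with `c ∉ [G, G]` except the open case `k ≥ 2`, `|ker w|` even `≥ 4`, `d = 0`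
  (`k = 1`: b23ʼs complemented law; `|ker w| ≤ 2`: `G` abelian, gen 37).

## References
* [Pohlmann1968] H. Pohlmann, Algebraic cycles on abelian varieties of complex multiplication type, Ann. of Math. 88 (1968), Thm 1.
* [Milne1999] J. S. Milne, Lefschetz motives and the Tate conjecture, Compositio Math. 117 (1999), Prop. 2.1, p. 54.
-/

namespace Summit.HodgeConjecture.CorCM.Census.CyclicCharacter

open Finset
open Summit.HodgeConjecture.CorCM.Prior.AllgGroup.RfwfAllgGroup
open Summit.HodgeConjecture.CorCM.Census.BlockParity
open Summit.HodgeConjecture.CorCM.Census.Coinvariant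
open Summit.HodgeConjecture.CorCM.Census.TwistGeneration
open Summit.HodgeConjecture.CorCM.Census.Nondegenerate
open Summit.HodgeConjecture.CorCM.Census.BaseBlock
open Summit.HodgeConjecture.CorCM.Census.Splitting

noncomputable section

variable {G : Type*} [Group G] [Fintype G] [DecidableEq G] {k : ℕ} {w : G → ZMod (2 ^ k)} {c : G}

/-! ## §1 The even laws -/

/-- **THE EVEN CYCLIC-SYLOW LAW: `μ(G, c) = φ₂(G, c)` and `φ₂(G, c) + 1 = β(G, c)`** for every finite `G` with a central involution `c` and an additive
`w : G ↠ ℤ/2ᵏ` (`k ≥ 2`), `w c ≠ 0`, whose kernel has EVEN size `2m ≥ 4`, and with `d = 1` (every `g` with `w g` odd has `c ∈ ⟨g⟩`). [folklore] -/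
theorem isLeast_card_gfaces_generate_of_even [Fintype (CMF G c)] (hw : ∀ P Q : G, w (P * Q) = w P + w Q) (hk : 1 ≤ k) (hk2 : 2 ≤ k)
    (hc2 : c * c = 1) (hcen : ∀ x : G, x * c = c * x) (hwc : w c ≠ 0) (h1 : ∃ g₁ : G, w g₁ = 1)
    (hroots : ∀ g : G, ¬ 2 ∣ (w g).val → c ∈ Subgroup.zpowers g)
    {m : ℕ} (hm : 2 * m = (univ.filter fun s : G => w s = 0).card) (hm2 : 2 ≤ m) :
    IsLeast {n : ℕ | ∃ S : Finset (CMF G c →₀ ℤ), (↑S ⊆ gfaceSet G c hc2) ∧ S.card = n ∧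
      hodgeSpan c hc2 ≤ Submodule.span ℤ (pairSet c) ⊔ Submodule.span ℤ (translates c S)} (fibreTwo c hc2) ∧
    fibreTwo c hc2 + 1 = Fintype.card (Block c) := by
  have hβ := fibreTwo_add_one_eq_card_block hw hk2 h1 hc2 hcen hwc hroots
  obtain ⟨S₀, hS₀f, hcard, hgen⟩ := exists_evenCert_generate hw hk hk2 hc2 hcen hwc h1 hm hm2
  have hge : fibreTwo c hc2 ≤ S₀.card := fibreTwo_le_card_of_faces c hc2 hcen S₀ hS₀f fun y hy => hgen (gfaceSet_subset_hodgeSpan c hc2 hy)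
  have hcardEq : S₀.card = fibreTwo c hc2 := by omega
  refine ⟨⟨⟨S₀, hS₀f, hcardEq, hgen⟩, ?_⟩, hβ⟩
  rintro n ⟨S, hS, rfl, hgen'⟩
  exact fibreTwo_le_card_of_faces c hc2 hcen S hS fun y hy => hgen' (gfaceSet_subset_hodgeSpan c hc2 hy)

/-- **THE EVEN KERNEL WITH `d = 0`: `φ₂(G, c) + 2 = β(G, c)` and `φ₂ ≤ μ(G, c) ≤ φ₂ + 1`** — the even certificate generates with `φ₂ + 1` faces; whether
`φ₂` faces suffice is OPEN (numerics `HOME/pub-hodgecm2-b09/lean-g43/py`: yes in every row computed, by a mechanism through the balanced types with an odd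
stabiliser element; see `EVEN-KERNEL-ROADMAP.md`). [folklore] -/
theorem exists_gfaces_generate_of_even_nonroot [Fintype (CMF G c)] (hw : ∀ P Q : G, w (P * Q) = w P + w Q) (hk : 1 ≤ k) (hk2 : 2 ≤ k)
    (hc2 : c * c = 1) (hcen : ∀ x : G, x * c = c * x) (hwc : w c ≠ 0) (h1 : ∃ g₁ : G, w g₁ = 1)
    (hnon : ∃ g : G, ¬ 2 ∣ (w g).val ∧ c ∉ Subgroup.zpowers g)
    {m : ℕ} (hm : 2 * m = (univ.filter fun s : G => w s = 0).card) (hm2 : 2 ≤ m) :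
    fibreTwo c hc2 + 2 = Fintype.card (Block c) ∧
    (∀ S : Finset (CMF G c →₀ ℤ), (↑S ⊆ gfaceSet G c hc2) →
      hodgeSpan c hc2 ≤ Submodule.span ℤ (pairSet c) ⊔ Submodule.span ℤ (translates c S) → fibreTwo c hc2 ≤ S.card) ∧
    ∃ S₀ : Finset (CMF G c →₀ ℤ), (↑S₀ ⊆ gfaceSet G c hc2) ∧ S₀.card ≤ fibreTwo c hc2 + 1 ∧
      hodgeSpan c hc2 ≤ Submodule.span ℤ (pairSet c) ⊔ Submodule.span ℤ (translates c S₀) := by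
  have hβ := fibreTwo_add_two_eq_card_block hw hk2 h1 hc2 hcen hwc hnon
  obtain ⟨S₀, hS₀f, hcard, hgen⟩ := exists_evenCert_generate hw hk hk2 hc2 hcen hwc h1 hm hm2
  refine ⟨hβ, fun S hS hgen' => fibreTwo_le_card_of_faces c hc2 hcen S hS fun y hy => hgen' (gfaceSet_subset_hodgeSpan c hc2 hy),
    S₀, hS₀f, by omega, hgen⟩

/-- **THE EVEN CYCLIC-SYLOW LAW, block form: `μ(G, c) = β(G, c) − 1`.** [folklore] -/
theorem isLeast_card_gfaces_generate_of_even_card_block [Fintype (CMF G c)] (hw : ∀ P Q : G, w (P * Q) = w P + w Q) (hk : 1 ≤ k)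
    (hk2 : 2 ≤ k) (hc2 : c * c = 1) (hcen : ∀ x : G, x * c = c * x) (hwc : w c ≠ 0) (h1 : ∃ g₁ : G, w g₁ = 1)
    (hroots : ∀ g : G, ¬ 2 ∣ (w g).val → c ∈ Subgroup.zpowers g)
    {m : ℕ} (hm : 2 * m = (univ.filter fun s : G => w s = 0).card) (hm2 : 2 ≤ m) :
    IsLeast {n : ℕ | ∃ S : Finset (CMF G c →₀ ℤ), (↑S ⊆ gfaceSet G c hc2) ∧ S.card = n ∧
      hodgeSpan c hc2 ≤ Submodule.span ℤ (pairSet c) ⊔ Submodule.span ℤ (translates c S)} (Fintype.card (Block c) - 1) := by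
  obtain ⟨h, hβ⟩ := isLeast_card_gfaces_generate_of_even hw hk hk2 hc2 hcen hwc h1 hroots hm hm2
  rw [← hβ, Nat.add_sub_cancel]
  exact h

/-! ## §2 One statement for every kernel of size `≥ 3` -/

/-- **THE CYCLIC-SYLOW LAW FOR `d = 1`, ANY KERNEL OF SIZE `≥ 3`** — gen 42ʼs odd-kernel law (part XXIII) and the even law in one statement: for `w ↠ ℤ/2ᵏ`
(`k ≥ 2`), `w c ≠ 0`, `|ker w| ≥ 3` and `d = 1`: **`μ(G, c) = φ₂(G, c) = β(G, c) − 1`**. [folklore] -/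
theorem isLeast_card_gfaces_generate_of_roots [Fintype (CMF G c)] (hw : ∀ P Q : G, w (P * Q) = w P + w Q) (hk : 1 ≤ k) (hk2 : 2 ≤ k)
    (hc2 : c * c = 1) (hcen : ∀ x : G, x * c = c * x) (hwc : w c ≠ 0) (h1 : ∃ g₁ : G, w g₁ = 1)
    (hroots : ∀ g : G, ¬ 2 ∣ (w g).val → c ∈ Subgroup.zpowers g) (h3 : 3 ≤ (univ.filter fun s : G => w s = 0).card) :
    IsLeast {n : ℕ | ∃ S : Finset (CMF G c →₀ ℤ), (↑S ⊆ gfaceSet G c hc2) ∧ S.card = n ∧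
      hodgeSpan c hc2 ≤ Submodule.span ℤ (pairSet c) ⊔ Submodule.span ℤ (translates c S)} (fibreTwo c hc2) ∧
    fibreTwo c hc2 + 1 = Fintype.card (Block c) := by
  obtain ⟨m, hm | hm⟩ := Nat.even_or_odd' ((univ.filter fun s : G => w s = 0).card)
  · exact isLeast_card_gfaces_generate_of_even hw hk hk2 hc2 hcen hwc h1 hroots hm.symm (by omega)
  · -- odd kernel: every kernel element has odd order (Lagrange in the kernel subgroup), and part XXIII applies
    let K : Subgroup G :=
      { carrier := {g | w g = 0}
        mul_mem' := fun {a b} ha hb => by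
          simp only [Set.mem_setOf_eq] at ha hb ⊢
          rw [hw, ha, hb, add_zero]
        one_mem' := map_one hw
        inv_mem' := fun {a} ha => by
          simp only [Set.mem_setOf_eq] at ha ⊢
          rw [map_inv hw, ha, neg_zero] }
    have hKcard : Nat.card K = (univ.filter fun s : G => w s = 0).card :=
      Nat.subtype_card _ fun x => by rw [mem_filter]; exact ⟨fun h => h.2, fun h => ⟨mem_univ _, h⟩⟩
    have hodd : ∀ g : G, w g = 0 → Odd (orderOf g) := fun g hg =>
      Odd.of_dvd_nat (by rw [hKcard, hm]; exact odd_two_mul_add_one m) (Subgroup.orderOf_dvd_natCard K (show g ∈ K from hg))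
    obtain ⟨n₀, n₁, hn₀1, -, -, hn₀, -⟩ := exists_two_ker hw h3
    exact isLeast_card_gfaces_generate_of_cyclic hw hk hk2 hc2 hcen hwc h1 hodd hn₀ hn₀1

/-- **THE CYCLIC-SYLOW LAW FOR `d = 1`, block form: `μ(G, c) = β(G, c) − 1`** for `|ker w| ≥ 3`. [folklore] -/
theorem isLeast_card_gfaces_generate_of_roots_card_block [Fintype (CMF G c)] (hw : ∀ P Q : G, w (P * Q) = w P + w Q) (hk : 1 ≤ k)
    (hk2 : 2 ≤ k) (hc2 : c * c = 1) (hcen : ∀ x : G, x * c = c * x) (hwc : w c ≠ 0) (h1 : ∃ g₁ : G, w g₁ = 1)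
    (hroots : ∀ g : G, ¬ 2 ∣ (w g).val → c ∈ Subgroup.zpowers g) (h3 : 3 ≤ (univ.filter fun s : G => w s = 0).card) :
    IsLeast {n : ℕ | ∃ S : Finset (CMF G c →₀ ℤ), (↑S ⊆ gfaceSet G c hc2) ∧ S.card = n ∧
      hodgeSpan c hc2 ≤ Submodule.span ℤ (pairSet c) ⊔ Submodule.span ℤ (translates c S)} (Fintype.card (Block c) - 1) := by
  obtain ⟨h, hβ⟩ := isLeast_card_gfaces_generate_of_roots hw hk hk2 hc2 hcen hwc h1 hroots h3
  rw [← hβ, Nat.add_sub_cancel]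
  exact h

end

end Summit.HodgeConjecture.CorCM.Census.CyclicCharacter
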